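import Summits.QuantumFields.YangMills.Theorems.LuscherReductionTwistedTraceScalingMehlerForm
import HarnessLib

/-!
# C4 INNER, brick S (part 2b): the MEHLER GAP — `0 ≤ ⟨f,Kf⟩ ≤ λ₀[(1−ρ)⟨f,h₀⟩² + ρ‖f‖²]` for the harmonic transfer kernel
# (lane A of S-BASE, crux `TwistedTraceScaling` stmt-QuantumFields-20203; sub-target C4, design note `pub/ym-fleet/ym-luscher-20007-p1/COARSE-DESIGN.md` §21.5 S;
# Wipf 2021 (8.58), Folland 1989 §1.7 (vii))

The stiff-sector gap `θ` of the Born–Oppenheimer package `InnerBOPackageAt` (`…InnerBOPackage`): for the Mehler kernel `K = mehlerKernel a b` (`0 < a_k`, `0 < b_k`,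
`a_k² + 2a_kb_k = π²`; eigenvalues `λ_α = λ₀ Π_k r_k^{α_k}`, `λ₀ = Π√(π/s_k)`, `r_k = b_k/s_k < 1`, `…MehlerHermite`) and every REAL `f ∈ L²(ℝ^σ)`:
`0 ≤ Q(f,f) ≤ λ₀·[(1−ρ)·c₀² + ρ·‖f‖₂²]`, `c₀ = ∫ f·hR 0` the ground-state coefficient, for any `ρ ∈ [max_k r_k, 1]` — i.e. `K ≤ λ₀ρ` on `h₀^⊥`.
Proof (Folland §1.7 (vii) = completeness of the Hermite functions, tree `Literature.Analysis.SegalBargmann.hermiteBasis`): with the partial Hermite sums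
`f_s = Σ_{α∈s} c_α hR_α` and `g_s = f − f_s`: `Q(f,f) = Q(f_s,f_s) + Q(g_s,g_s)` EXACTLY (the cross terms vanish since `K hR_β = λ_β hR_β` and `g_s ⊥ hR_β`),
`Q(f_s,f_s) = Σ_{α∈s} λ_α c_α² ≤ λ₀[(1−ρ)c₀² + ρ Σ_s c_α²]`, `|Q(g_s,g_s)| ≤ M‖g_s‖² = M(‖f‖² − Σ_s c_α²)` (Schur, `…MehlerForm`), and PARSEVAL `Σ_s c_α² → ‖f‖²`.
* §1 finite Hermite sums: `MemLp`, coefficients, `∫ g_s·hR_β = 0`, `‖g_s‖² = ‖f‖² − Σ_s c_α²`, `Q(u, f_s) = Σ_s c_α Q(u, hR_α)`;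
* §2 ★ `mehlerForm_split : Q(f,f) = Σ_{α∈s} λ_α c_α² + Q(g_s,g_s)`;
* §3 Parseval for the real coefficients (`hasSum_sq_hermCoeff`);
* §4 ★★★ `mehlerForm_nonneg`, ★★★ `mehlerForm_le_gap`.
HONEST FRAMING: classical `L²` spectral bound (Mehler 1866 / Wipf (8.58)) for a stub of a child of the CONDITIONAL reduction route (femto rung R2b1); not infinite volume, not a gap, not Clay.

## References
* G. B. Folland, *Harmonic Analysis in Phase Space*, Princeton UP 1989, §1.7 (vii). [Folland1989]
* A. Wipf, *Statistical Approach to Quantum Field Theory*, LNP 992, Springer 2021, §8.5.1 (8.58). [Wipf2021]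
-/

set_option autoImplicit false

open MvPolynomial Complex MeasureTheory Filter Topology
open scoped Real InnerProductSpace

namespace Summit.QuantumFields.YangMills.Theorems.FemtoTransferGap.Mehler

open Literature.Analysis.SegalBargmann Literature.Analysis.OperatorTheory

noncomputable section

variable {σ : Type*} [Fintype σ] [DecidableEq σ]

/-! ### §1 Finite Hermite sums -/

/-- The real Hermite coefficient `c_α(f) = ∫ f · hR α`. [cite: Folland1989, §1.7 (vii)] -/
def hermCoeff (f : (σ → ℝ) → ℝ) (α : σ →₀ ℕ) : ℝ := ∫ x, f x * hR α x

/-- The partial Hermite sum `f_s = Σ_{α∈s} c_α hR α`. [cite: Folland1989, §1.7 (vii)] -/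
def hermSum (f : (σ → ℝ) → ℝ) (s : Finset (σ →₀ ℕ)) : (σ → ℝ) → ℝ := fun x => ∑ α ∈ s, hermCoeff f α * hR α x

/-- Finite Hermite sums are in `L²`. [folklore] -/
theorem memLp_hermSum (f : (σ → ℝ) → ℝ) (s : Finset (σ →₀ ℕ)) : MemLp (hermSum f s) 2 (volume : Measure (σ → ℝ)) := by
  unfold hermSum
  exact memLp_finsetSum s fun α _ => (memLp_hR α).const_mul _

omit [DecidableEq σ] in
/-- Products of `L²` functions are integrable. [folklore] -/
theorem integrable_mul_of_memLp {u w : (σ → ℝ) → ℝ} (hu : MemLp u 2 (volume : Measure (σ → ℝ))) (hw : MemLp w 2 (volume : Measure (σ → ℝ))) :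
    Integrable (fun x => u x * w x) := hu.integrable_mul hw

/-- `∫ f_s · hR β = c_β` for `β ∈ s`, `0` otherwise. [cite: Folland1989, §1.7 (vii)] -/
theorem integral_hermSum_mul_hR {f : (σ → ℝ) → ℝ} (s : Finset (σ →₀ ℕ)) (β : σ →₀ ℕ) :
    ∫ x, hermSum f s x * hR β x = if β ∈ s then hermCoeff f β else 0 := by
  unfold hermSum
  simp_rw [Finset.sum_mul]
  rw [integral_finsetSum _ fun α _ => ((integrable_mul_of_memLp (memLp_hR α) (memLp_hR β)).const_mul (hermCoeff f α)).congr
    (ae_of_all _ fun x => by ring)]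
  have h : ∀ α ∈ s, ∫ x, hermCoeff f α * hR α x * hR β x = hermCoeff f α * if α = β then (1 : ℝ) else 0 := fun α _ => by
    rw [← integral_hR_mul_hR α β, ← integral_const_mul]
    exact integral_congr_ae (ae_of_all _ fun x => by ring)
  rw [Finset.sum_congr rfl h]
  simp [Finset.sum_ite_eq', mul_comm]

/-- `∫ (f − f_s) · hR β = 0` for `β ∈ s`. [cite: Folland1989, §1.7 (vii)] -/
theorem integral_sub_hermSum_mul_hR {f : (σ → ℝ) → ℝ} (hf : MemLp f 2 (volume : Measure (σ → ℝ))) {s : Finset (σ →₀ ℕ)} {β : σ →₀ ℕ} (hβ : β ∈ s) :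
    ∫ x, (f - hermSum f s) x * hR β x = 0 := by
  have e : (fun x => (f - hermSum f s) x * hR β x) = fun x => f x * hR β x - hermSum f s x * hR β x := by
    funext x; simp only [Pi.sub_apply]; ring
  rw [e, integral_sub (integrable_mul_of_memLp hf (memLp_hR β)) (integrable_mul_of_memLp (memLp_hermSum f s) (memLp_hR β)),
    integral_hermSum_mul_hR, if_pos hβ]
  exact sub_self _

/-- `∫ (f − f_s) · f_s = 0`. [cite: Folland1989, §1.7 (vii)] -/
theorem integral_sub_hermSum_mul_hermSum {f : (σ → ℝ) → ℝ} (hf : MemLp f 2 (volume : Measure (σ → ℝ))) (s : Finset (σ →₀ ℕ)) :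
    ∫ x, (f - hermSum f s) x * hermSum f s x = 0 := by
  have e : (fun x => (f - hermSum f s) x * hermSum f s x) = fun x => ∑ α ∈ s, hermCoeff f α * ((f - hermSum f s) x * hR α x) := by
    funext x; rw [hermSum, Finset.mul_sum]; exact Finset.sum_congr rfl fun α _ => by ring
  rw [e, integral_finsetSum _ fun α _ => ((integrable_mul_of_memLp (hf.sub (memLp_hermSum f s)) (memLp_hR α)).const_mul _)]
  refine Finset.sum_eq_zero fun α hα => ?_
  rw [integral_const_mul, integral_sub_hermSum_mul_hR hf hα, mul_zero]

/-- Bessel as an identity: `‖f − f_s‖² = ‖f‖² − Σ_{α∈s} c_α²`. [cite: Folland1989, §1.7 (vii)] -/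
theorem integral_sub_hermSum_sq {f : (σ → ℝ) → ℝ} (hf : MemLp f 2 (volume : Measure (σ → ℝ))) (s : Finset (σ →₀ ℕ)) :
    ∫ x, (f - hermSum f s) x ^ 2 = (∫ x, f x ^ 2) - ∑ α ∈ s, hermCoeff f α ^ 2 := by
  -- `(f − f_s)² = (f − f_s) f − (f − f_s) f_s`, the second integrates to `0`, the first to `‖f‖² − Σ c_α ∫ f hR α`
  have e : (fun x => (f - hermSum f s) x ^ 2) = fun x => (f - hermSum f s) x * f x - (f - hermSum f s) x * hermSum f s x := by
    funext x; simp only [Pi.sub_apply]; ring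
  rw [e, integral_sub (integrable_mul_of_memLp (hf.sub (memLp_hermSum f s)) hf) (integrable_mul_of_memLp (hf.sub (memLp_hermSum f s)) (memLp_hermSum f s)),
    integral_sub_hermSum_mul_hermSum hf s, sub_zero]
  have e2 : (fun x => (f - hermSum f s) x * f x) = fun x => f x ^ 2 - ∑ α ∈ s, hermCoeff f α * (f x * hR α x) := by
    funext x
    rw [Pi.sub_apply, hermSum, sub_mul, Finset.sum_mul, sq]
    congr 1
    exact Finset.sum_congr rfl fun α _ => by ring
  rw [e2, integral_sub hf.integrable_sq (integrable_finsetSum _ fun α _ => (integrable_mul_of_memLp hf (memLp_hR α)).const_mul _),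
    integral_finsetSum _ fun α _ => (integrable_mul_of_memLp hf (memLp_hR α)).const_mul _]
  congr 1
  refine Finset.sum_congr rfl fun α _ => ?_
  rw [integral_const_mul, hermCoeff, sq]

/-- Right-linearity of the form over a finite Hermite sum: `Q(u, f_s) = Σ_{β∈s} c_β Q(u, hR β)`. [folklore] -/
theorem mehlerForm_hermSum_right {a b : σ → ℝ} (ha : ∀ k, 0 < a k) (hb : ∀ k, 0 ≤ b k) {u : (σ → ℝ) → ℝ} (hu : MemLp u 2 (volume : Measure (σ → ℝ)))
    (f : (σ → ℝ) → ℝ) (s : Finset (σ →₀ ℕ)) :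
    mehlerForm a b u (hermSum f s) = ∑ β ∈ s, hermCoeff f β * mehlerForm a b u (hR β) := by
  induction s using Finset.induction_on with
  | empty =>
      have e : hermSum f ∅ = (0 : ℝ) • hR (0 : σ →₀ ℕ) := by funext x; simp [hermSum]
      rw [e, mehlerForm_smul_right, zero_mul, Finset.sum_empty]
  | insert β s hβ ih =>
      have e : hermSum f (insert β s) = hermCoeff f β • hR β + hermSum f s := by
        funext x; simp [hermSum, Finset.sum_insert hβ]
      rw [e, mehlerForm_add_right ha hb hu ((memLp_hR β).const_smul _) (memLp_hermSum f s), mehlerForm_smul_right, ih, Finset.sum_insert hβ]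

/-! ### §2 The exact splitting `Q(f,f) = Σ_s λ_α c_α² + Q(g_s, g_s)` -/

omit [DecidableEq σ] in
/-- The form is symmetric. [folklore] -/
theorem mehlerForm_comm {a b : σ → ℝ} (ha : ∀ k, 0 < a k) (hb : ∀ k, 0 ≤ b k) {u w : (σ → ℝ) → ℝ} (hu : MemLp u 2 (volume : Measure (σ → ℝ)))
    (hw : MemLp w 2 (volume : Measure (σ → ℝ))) : mehlerForm a b u w = mehlerForm a b w u := by
  rw [mehlerForm_eq_integral_prod ha hb hu hw, mehlerForm,
    integral_prod_symm (fun p : (σ → ℝ) × (σ → ℝ) => u p.1 * mehlerKernel a b p.1 p.2 * w p.2) (integrable_mehlerForm_integrand ha hb hu hw)]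
  refine integral_congr_ae (ae_of_all _ fun y => integral_congr_ae (ae_of_all _ fun x => ?_))
  simp only
  rw [mehlerKernel_comm a b x y]; ring

/-- `Q(g_s, f_s) = 0`: the remainder is `K`-orthogonal to the partial sum. [cite: Folland1989, §1.7 (vii)] -/
theorem mehlerForm_sub_hermSum_hermSum {a b : σ → ℝ} (ha : ∀ k, 0 < a k) (hb : ∀ k, 0 < b k) (hab : ∀ k, a k ^ 2 + 2 * a k * b k = π ^ 2)
    {f : (σ → ℝ) → ℝ} (hf : MemLp f 2 (volume : Measure (σ → ℝ))) (s : Finset (σ →₀ ℕ)) :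
    mehlerForm a b (f - hermSum f s) (hermSum f s) = 0 := by
  have hs : ∀ k, 0 < a k + b k + π := fun k => by have := Real.pi_pos; linarith [ha k, hb k]
  rw [mehlerForm_hermSum_right ha (fun k => (hb k).le) (hf.sub (memLp_hermSum f s))]
  refine Finset.sum_eq_zero fun β hβ => ?_
  rw [mehlerForm_hR_right hs hab, integral_sub_hermSum_mul_hR hf hβ, mul_zero, mul_zero]

/-- `Q(f_s, f_s) = Σ_{α∈s} λ_α c_α²`. [cite: Wipf2021, §8.5.1 (8.58)] -/
theorem mehlerForm_hermSum_hermSum {a b : σ → ℝ} (ha : ∀ k, 0 < a k) (hb : ∀ k, 0 < b k) (hab : ∀ k, a k ^ 2 + 2 * a k * b k = π ^ 2)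
    (f : (σ → ℝ) → ℝ) (s : Finset (σ →₀ ℕ)) :
    mehlerForm a b (hermSum f s) (hermSum f s) =
      ∑ α ∈ s, ((∏ k, Real.sqrt (π / (a k + b k + π))) * ∏ k, (b k / (a k + b k + π)) ^ (α k)) * hermCoeff f α ^ 2 := by
  have hs : ∀ k, 0 < a k + b k + π := fun k => by have := Real.pi_pos; linarith [ha k, hb k]
  rw [mehlerForm_hermSum_right ha (fun k => (hb k).le) (memLp_hermSum f s)]
  refine Finset.sum_congr rfl fun β hβ => ?_
  rw [mehlerForm_hR_right hs hab, integral_hermSum_mul_hR, if_pos hβ]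
  ring

/-- ★ **Exact splitting**: `Q(f,f) = Σ_{α∈s} λ_α c_α² + Q(f − f_s, f − f_s)`. [cite: Folland1989, §1.7 (vii)] -/
theorem mehlerForm_split {a b : σ → ℝ} (ha : ∀ k, 0 < a k) (hb : ∀ k, 0 < b k) (hab : ∀ k, a k ^ 2 + 2 * a k * b k = π ^ 2)
    {f : (σ → ℝ) → ℝ} (hf : MemLp f 2 (volume : Measure (σ → ℝ))) (s : Finset (σ →₀ ℕ)) :
    mehlerForm a b f f = (∑ α ∈ s, ((∏ k, Real.sqrt (π / (a k + b k + π))) * ∏ k, (b k / (a k + b k + π)) ^ (α k)) * hermCoeff f α ^ 2) +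
      mehlerForm a b (f - hermSum f s) (f - hermSum f s) := by
  have hb' : ∀ k, 0 ≤ b k := fun k => (hb k).le
  have hg := hf.sub (memLp_hermSum f s)
  have hS := memLp_hermSum f s
  have e : f = (f - hermSum f s) + hermSum f s := by rw [sub_add_cancel]
  conv_lhs => rw [e]
  rw [mehlerForm_add_left ha hb' hg hS (hg.add hS), mehlerForm_add_right ha hb' hg hg hS, mehlerForm_add_right ha hb' hS hg hS,
    mehlerForm_sub_hermSum_hermSum ha hb hab hf s, mehlerForm_comm ha hb' hS hg, mehlerForm_sub_hermSum_hermSum ha hb hab hf s,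
    mehlerForm_hermSum_hermSum ha hb hab f s]
  ring

/-! ### §3 Parseval for the real Hermite coefficients -/

/-- ★ **Parseval**: `Σ_α c_α(f)² = ‖f‖₂²` (completeness of the Hermite functions, `hermiteBasis`). [cite: Folland1989, §1.7 (vii)] -/
theorem hasSum_sq_hermCoeff {f : (σ → ℝ) → ℝ} (hf : MemLp f 2 (volume : Measure (σ → ℝ))) :
    HasSum (fun α : σ →₀ ℕ => hermCoeff f α ^ 2) (∫ x, f x ^ 2) := by
  set F : Lp ℂ 2 (volume : Measure (σ → ℝ)) := (hf.ofReal (K := ℂ)).toLp _ with hF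
  have hFf : ⇑F =ᵐ[volume] fun x => ((f x : ℝ) : ℂ) := MemLp.coeFn_toLp _
  -- the coefficients of `F` in the Hermite basis are the real coefficients
  have hc : ∀ α, ⟪hermiteBasis α, F⟫_ℂ = ((hermCoeff f α : ℝ) : ℂ) := fun α => by
    rw [hermiteBasis_apply, inner_hermiteL2_left, hermCoeff, ← integral_complex_ofReal]
    refine integral_congr_ae ?_
    filter_upwards [hFf] with x hx
    rw [hx, hermiteFun_herm_eq_ofReal, Complex.conj_ofReal]
    push_cast
    ring
  have hc' : ∀ α, ⟪F, hermiteBasis α⟫_ℂ = ((hermCoeff f α : ℝ) : ℂ) := fun α => by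
    rw [← inner_conj_symm, hc, Complex.conj_ofReal]
  -- `⟪F, F⟫ = ∫ f²`
  have hFF : ⟪F, F⟫_ℂ = (((∫ x, f x ^ 2 : ℝ)) : ℂ) := by
    rw [MeasureTheory.L2.inner_def, ← integral_complex_ofReal]
    refine integral_congr_ae ?_
    filter_upwards [hFf] with x hx
    rw [hx, RCLike.inner_apply, Complex.conj_ofReal]
    push_cast
    ring
  have h := (hermiteBasis (σ := σ)).hasSum_inner_mul_inner F F
  simp_rw [hc, hc', hFF, ← Complex.ofReal_mul] at h
  have h2 := (Complex.hasSum_ofReal).mp h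
  refine h2.congr_fun fun α => ?_
  ring

/-! ### §4 ★★★ The Mehler gap -/

/-- The eigenvalue weights are bounded: `0 ≤ Π r_k^{α_k} ≤ 1`, and `≤ ρ` for `α ≠ 0` when `r_k ≤ ρ`, `0 ≤ ρ`. [cite: Wipf2021, §8.5.1 (8.58)] -/
theorem eigenWeight_le {a b : σ → ℝ} (ha : ∀ k, 0 < a k) (hb : ∀ k, 0 < b k) {ρ : ℝ} (hρ0 : 0 ≤ ρ) (hρ : ∀ k, b k / (a k + b k + π) ≤ ρ)
    (α : σ →₀ ℕ) :
    0 ≤ ∏ k, (b k / (a k + b k + π)) ^ (α k) ∧ ∏ k, (b k / (a k + b k + π)) ^ (α k) ≤ 1 ∧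
      (α ≠ 0 → ∏ k, (b k / (a k + b k + π)) ^ (α k) ≤ ρ) := by
  have hs : ∀ k, 0 < a k + b k + π := fun k => by have := Real.pi_pos; linarith [ha k, hb k]
  have hr0 : ∀ k, 0 ≤ b k / (a k + b k + π) := fun k => div_nonneg (hb k).le (hs k).le
  have hr1 : ∀ k, b k / (a k + b k + π) ≤ 1 := fun k => by
    rw [div_le_one (hs k)]; have := Real.pi_pos; linarith [ha k]
  refine ⟨Finset.prod_nonneg fun k _ => pow_nonneg (hr0 k) _,
    Finset.prod_le_one (fun k _ => pow_nonneg (hr0 k) _) fun k _ => pow_le_one₀ (hr0 k) (hr1 k), fun hα => ?_⟩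
  obtain ⟨j, hj⟩ : ∃ j, α j ≠ 0 := by
    by_contra hcon; push Not at hcon; exact hα (Finsupp.ext hcon)
  rw [← Finset.mul_prod_erase _ _ (Finset.mem_univ j)]
  have h1 : (b j / (a j + b j + π)) ^ (α j) ≤ ρ := by
    obtain ⟨m, hm⟩ := Nat.exists_eq_succ_of_ne_zero hj
    rw [hm, pow_succ]
    calc (b j / (a j + b j + π)) ^ m * (b j / (a j + b j + π)) ≤ 1 * ρ :=
          mul_le_mul (pow_le_one₀ (hr0 j) (hr1 j)) (hρ j) (hr0 j) zero_le_one
      _ = ρ := one_mul ρ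
  have h2 : ∏ k ∈ Finset.univ.erase j, (b k / (a k + b k + π)) ^ (α k) ≤ 1 :=
    Finset.prod_le_one (fun k _ => pow_nonneg (hr0 k) _) fun k _ => pow_le_one₀ (hr0 k) (hr1 k)
  calc (b j / (a j + b j + π)) ^ (α j) * ∏ k ∈ Finset.univ.erase j, (b k / (a k + b k + π)) ^ (α k) ≤ ρ * 1 :=
        mul_le_mul h1 h2 (Finset.prod_nonneg fun k _ => pow_nonneg (hr0 k) _) hρ0
    _ = ρ := mul_one ρ

/-- The finite spectral sum is bounded by the gap expression: `Σ_{α∈s} λ_α c_α² ≤ λ₀[(1−ρ)c₀² + ρ Σ_{α∈s} c_α²]`. [cite: Wipf2021, §8.5.1 (8.58)] -/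
theorem sum_eigenWeight_sq_le {a b : σ → ℝ} (ha : ∀ k, 0 < a k) (hb : ∀ k, 0 < b k) {ρ : ℝ} (hρ0 : 0 ≤ ρ) (hρ : ∀ k, b k / (a k + b k + π) ≤ ρ)
    (hρ1 : ρ ≤ 1) (c : (σ →₀ ℕ) → ℝ) (s : Finset (σ →₀ ℕ)) :
    ∑ α ∈ s, ((∏ k, Real.sqrt (π / (a k + b k + π))) * ∏ k, (b k / (a k + b k + π)) ^ (α k)) * c α ^ 2 ≤
      (∏ k, Real.sqrt (π / (a k + b k + π))) * ((1 - ρ) * c 0 ^ 2 + ρ * ∑ α ∈ s, c α ^ 2) := by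
  set L := ∏ k, Real.sqrt (π / (a k + b k + π)) with hL
  have hL0 : 0 ≤ L := Finset.prod_nonneg fun k _ => Real.sqrt_nonneg _
  -- termwise: `λ_α c_α² ≤ L ρ c_α² + [α = 0] L (1−ρ) c_0²`
  have hterm : ∀ α ∈ s, (L * ∏ k, (b k / (a k + b k + π)) ^ (α k)) * c α ^ 2 ≤
      L * (ρ * c α ^ 2) + (if α = 0 then L * ((1 - ρ) * c 0 ^ 2) else 0) := fun α _ => by
    obtain ⟨h0, h1, hne⟩ := eigenWeight_le ha hb hρ0 hρ α
    by_cases hα : α = 0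
    · subst hα
      rw [if_pos rfl]
      have : L * (∏ k, (b k / (a k + b k + π)) ^ ((0 : σ →₀ ℕ) k)) * c 0 ^ 2 ≤ L * 1 * c 0 ^ 2 :=
        mul_le_mul_of_nonneg_right (mul_le_mul_of_nonneg_left h1 hL0) (sq_nonneg _)
      nlinarith [sq_nonneg (c 0)]
    · rw [if_neg hα, add_zero]
      have := hne hα
      have : L * (∏ k, (b k / (a k + b k + π)) ^ (α k)) * c α ^ 2 ≤ L * ρ * c α ^ 2 :=
        mul_le_mul_of_nonneg_right (mul_le_mul_of_nonneg_left this hL0) (sq_nonneg _)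
      linarith
  refine (Finset.sum_le_sum hterm).trans ?_
  rw [Finset.sum_add_distrib, ← Finset.mul_sum, ← Finset.mul_sum, Finset.sum_ite_eq' ]
  split_ifs with h0
  · linarith
  · have : 0 ≤ L * ((1 - ρ) * c 0 ^ 2) := mul_nonneg hL0 (mul_nonneg (by linarith) (sq_nonneg _))
    linarith

/-- ★★★ **THE MEHLER GAP.**  For `0 < a_k`, `0 < b_k`, `a_k² + 2a_kb_k = π²`, `r_k = b_k/(a_k+b_k+π) ≤ ρ ≤ 1`, `0 ≤ ρ`, and every real `f ∈ L²(ℝ^σ)`: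
`Q(f,f) ≤ λ₀ · [(1 − ρ)·c₀(f)² + ρ·‖f‖₂²]`, `λ₀ = Π_k √(π/(a_k+b_k+π))`, `c₀(f) = ∫ f·hR 0` — i.e. `K ≤ λ₀ρ` on the orthogonal complement of the ground state.
[cite: Wipf2021, §8.5.1 (8.58)] [cite: Folland1989, §1.7 (vii)] -/
theorem mehlerForm_le_gap {a b : σ → ℝ} (ha : ∀ k, 0 < a k) (hb : ∀ k, 0 < b k) (hab : ∀ k, a k ^ 2 + 2 * a k * b k = π ^ 2)
    {ρ : ℝ} (hρ0 : 0 ≤ ρ) (hρ : ∀ k, b k / (a k + b k + π) ≤ ρ) (hρ1 : ρ ≤ 1) {f : (σ → ℝ) → ℝ} (hf : MemLp f 2 (volume : Measure (σ → ℝ))) :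
    mehlerForm a b f f ≤ (∏ k, Real.sqrt (π / (a k + b k + π))) * ((1 - ρ) * hermCoeff f 0 ^ 2 + ρ * ∫ x, f x ^ 2) := by
  set L := ∏ k, Real.sqrt (π / (a k + b k + π)) with hL
  set M := ∏ k, Real.sqrt (π / a k) with hM
  have hb' : ∀ k, 0 ≤ b k := fun k => (hb k).le
  -- along the partial sums: `Q(f,f) ≤ L[(1−ρ)c₀² + ρ S_s] + M(‖f‖² − S_s)`, `S_s = Σ_s c_α²`
  have hstep : ∀ s : Finset (σ →₀ ℕ), mehlerForm a b f f ≤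
      L * ((1 - ρ) * hermCoeff f 0 ^ 2 + ρ * ∑ α ∈ s, hermCoeff f α ^ 2) + M * ((∫ x, f x ^ 2) - ∑ α ∈ s, hermCoeff f α ^ 2) := fun s => by
    have hg := hf.sub (memLp_hermSum f s)
    rw [mehlerForm_split ha hb hab hf s]
    refine add_le_add (sum_eigenWeight_sq_le ha hb hρ0 hρ hρ1 (hermCoeff f) s) ?_
    have h := (abs_le.mp (abs_mehlerForm_le ha hb' hg hg)).2
    rw [← integral_sub_hermSum_sq hf s]
    refine h.trans (le_of_eq ?_)
    rw [hM, Real.mul_self_sqrt (integral_nonneg fun x => sq_nonneg _)]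
  -- the limit `S_s → ‖f‖²` (Parseval)
  have hP := hasSum_sq_hermCoeff hf
  have hT : Tendsto (fun s : Finset (σ →₀ ℕ) => L * ((1 - ρ) * hermCoeff f 0 ^ 2 + ρ * ∑ α ∈ s, hermCoeff f α ^ 2) +
      M * ((∫ x, f x ^ 2) - ∑ α ∈ s, hermCoeff f α ^ 2)) atTop
      (𝓝 (L * ((1 - ρ) * hermCoeff f 0 ^ 2 + ρ * ∫ x, f x ^ 2) + M * ((∫ x, f x ^ 2) - ∫ x, f x ^ 2))) :=
    ((tendsto_const_nhds.add (hP.const_mul ρ)).const_mul L).add ((tendsto_const_nhds.sub hP).const_mul M)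
  rw [sub_self, mul_zero, add_zero] at hT
  exact ge_of_tendsto' hT hstep

/-- ★★★ **Positivity**: `0 ≤ Q(f,f)` for real `f ∈ L²`. [cite: Wipf2021, §8.5.1 (8.58)] -/
theorem mehlerForm_nonneg {a b : σ → ℝ} (ha : ∀ k, 0 < a k) (hb : ∀ k, 0 < b k) (hab : ∀ k, a k ^ 2 + 2 * a k * b k = π ^ 2)
    {f : (σ → ℝ) → ℝ} (hf : MemLp f 2 (volume : Measure (σ → ℝ))) : 0 ≤ mehlerForm a b f f := by
  set L := ∏ k, Real.sqrt (π / (a k + b k + π)) with hL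
  set M := ∏ k, Real.sqrt (π / a k) with hM
  have hb' : ∀ k, 0 ≤ b k := fun k => (hb k).le
  have hstep : ∀ s : Finset (σ →₀ ℕ), -(M * ((∫ x, f x ^ 2) - ∑ α ∈ s, hermCoeff f α ^ 2)) ≤ mehlerForm a b f f := fun s => by
    have hg := hf.sub (memLp_hermSum f s)
    rw [mehlerForm_split ha hb hab hf s]
    have hsum : 0 ≤ ∑ α ∈ s, (L * ∏ k, (b k / (a k + b k + π)) ^ (α k)) * hermCoeff f α ^ 2 :=
      Finset.sum_nonneg fun α _ => mul_nonneg (mul_nonneg (Finset.prod_nonneg fun k _ => Real.sqrt_nonneg _)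
        (Finset.prod_nonneg fun k _ => pow_nonneg (div_nonneg (hb k).le (by have := Real.pi_pos; linarith [ha k, hb k])) _)) (sq_nonneg _)
    have h := (abs_le.mp (abs_mehlerForm_le ha hb' hg hg)).1
    rw [← integral_sub_hermSum_sq hf s]
    rw [hM] at *
    rw [Real.mul_self_sqrt (integral_nonneg fun x => sq_nonneg _)] at h
    linarith
  have hP := hasSum_sq_hermCoeff hf
  have hT : Tendsto (fun s : Finset (σ →₀ ℕ) => -(M * ((∫ x, f x ^ 2) - ∑ α ∈ s, hermCoeff f α ^ 2))) atTop
      (𝓝 (-(M * ((∫ x, f x ^ 2) - ∫ x, f x ^ 2)))) := ((tendsto_const_nhds.sub hP).const_mul M).neg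
  rw [sub_self, mul_zero, neg_zero] at hT
  exact le_of_tendsto' hT hstep

end

end Summit.QuantumFields.YangMills.Theorems.FemtoTransferGap.Mehler
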